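import Literature.AlgebraicGeometry.Shioda1982.HodgeQuadruplesTwoThreePower
import Literature.AlgebraicGeometry.Shioda1982.StandardQuadrupleLetter
import Literature.AlgebraicGeometry.HodgeTheory.FermatHodgeMultisetTransfer
import HarnessLib

/-!
# Hodge quadruples of the Fermat surface at the levels `m = 2ᵃ·3ᵇ`, part II: the inductive step (unit case, halving, thirding)

Topic `Literature/AlgebraicGeometry/Shioda1982`. Two definitions of record (`IsStdMultiset`, `IsSmallLift`: the vocabulary of
the classification carried through the induction) and THEOREMS; no named fact, no `sorry`. Second file of the series treating
[Aoki1983, Thm. C] = [AokiShioda1983, Thm. (𝔅²ₘ) (ii)] = [Shioda1982PicardFermat, Prop. 4 (Q′)] ("for `m > 180` every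
indecomposable primitive element of `𝔅²ₘ` is one of `αᵢ, βᵢ` (`m = 2m′`), `γⱼ` (`m = 3m″`)") at the levels `m = 2ᵃ3ᵇ` without
a prime factor `≥ 5` (cell `pub-hfermat`, LIT lane, `SCOPING-ThmC-general.md` §24), after part I
(`HodgeQuadruplesTwoThreePower`: the Koblitz–Ogus class relation, the hexagon, twin-or-`γ`). In print these levels rest on
Aoki's structure theory of `𝔅¹ₘ` ([Aoki1983, Thm. D]), absent from the tree; the route here is this formalisation's: an
INDUCTION ON THE LEVEL through the transfers `2N → N`, `3N → N` of [Aoki1983, Prop. 2.2]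
(`FermatCharacter.isHodgeMultiset_transfer_two/three`), as in `PicardNumberTwoPowerPrime` (`2ᵏp`).

THE CARRIED STATEMENT `T(L)`: every pair-free Hodge `4`-multiset over `ℤ/L` is STANDARD — `α_x = {x, x + L/2, −2x, L/2}`,
`β_x = {x, x + L/2, 2x + L/2, −4x}` or `γ_x = {x, x + L/3, x + 2L/3, −3x}` for some residue `x` (units or not: the multiples
`d·α_{x′} = α_{dx′}` of the standard elements of the levels `L/d`, `𝔍²_L(d) ≅ 𝔍²_{L/d}(1)` [Shioda1982PicardFermat, §2], are
standard in this sense), `IsStdMultiset` — or a LIFT FROM A LEVEL `≤ 72`: all members divisible by a divisor `d` of `L` with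
`L/d ≤ 72`, `IsSmallLift` (at the levels `2ᵃ3ᵇ ≤ 72` live the exceptional rows `12, 18, 24, 36, 48, 72` of
[MeyerNeutsch1981Fermatquadrupel, Tabelle 1], whose multiples are the non-standard indecomposables at every level `2ᵃ3ᵇ`;
`d = 1` is allowed, so `T(L)` is void for `L ≤ 72`). For a PRIMITIVE quadruple at a level `L > 72`, `T(L)` says "standard"
(part IV turns this into `¬ IsExceptionalQuadruple`).

* `std_or_small_of_all_even`, `std_or_small_of_all_three`: a pair-free Hodge quadruple all of whose members are even
  (divisible by `3`) is `2·s′` (`3·s′`) for a pair-free Hodge quadruple `s′` of level `m/2` (`m/3`) — the transfer applied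
  to `s = 0 + s` — so `T(m/2)` (`T(m/3)`) transports (`2, 3 ∣ m/2` resp. `m/3`).
* **`twin_transfer`** (the device of `PicardNumberTwoPowerPrime`, case of two odd members, at a general level `m = 2N`,
  `2 ∣ N`, `3 ∣ N`, `4 ∣ N` or `9 ∣ N`, `N > 72`, given `T(N)`): for a pair-free Hodge `s = {y, y + N, z, w}` with `y` odd, `z, w` even, the
  transfer makes `τ = {ȳ, z/2, w/2, N/2}` a Hodge quadruple of level `N`, and `T(N)` read back at level `m` leaves:
  `{z, w} = {−2y, N}` (`α_y`) | `{z, w} = {2y + N, −4y}` (`β_y`) | `{2y, z, w}` a coset of `(m/3)ℤ` | `3 ∣ y, z, w` |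
  a divisor `d ≥ 2` of `N` dividing `⟨y⟩, ⟨z⟩/2, ⟨w⟩/2`. (Used here for a unit `y`, and in part III for an odd multiple of `3`.)
* **`isStdMultiset_of_unit_mem_twoThreePower`** (`m = 2ᵃ3ᵇ`, `a, b ≥ 2`, `m > 144`, given `T(m/2)`): a pair-free Hodge
  quadruple with a member `y` prime to `m` is `α_y`, `β_y` or `γ_y` — part I's twin-or-`γ` and twin shape, then the twin
  transfer, whose last three alternatives contradict `(y, m) = 1`.
* **`std_or_small_step_twoThreePower`**: `T(m/2) ∧ T(m/3) ∧ [no MIXED pair-free Hodge quadruple at level m] ⟹ T(m)` for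
  `m = 2ᵃ3ᵇ`, `a, b ≥ 2`, `m > 144`, where MIXED means: no member prime to `m`, an odd member, and a member prime to `3`.
  The mixed configurations are excluded in part III (iterated transfers and the hexagon of part I at the levels `m/2ᶠ`,
  `m/3ᵉ`); part IV runs the induction down to the levels `≤ 630` of the kernel sweeps and the prime powers.

Cross-checks outside Lean (cell `pub-hfermat`, `pub-hfermat-lit/g39-session/towers/enum_b2.py`): at `m = 144, 216, 288, 432,
576, 648, 864` every indecomposable Hodge `4`-multiset is `α_x/β_x/γ_x` or one of the `110` (`94` when `16 ∤ m`) lifts of the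
Meyer–Neutsch exceptional quadruples of the levels `12, …, 72`; the ones with a unit member are exactly the `α_y, β_y`
(two units) and `γ_y` (three units); the ones without a unit member are all-even or all-divisible-by-`3`, never mixed.

HONEST FRAMING (cell `pub-hfermat`): explicit algebraic cycles for specific Hodge classes on Fermat/Delsarte varieties; residual
open instances listed; no claim on general Hodge. (Surface classes are algebraic by Lefschetz (1,1); this file proves
structure statements about Shioda's Hodge condition towards a printed theorem; no cycle is constructed here.)

## References
* [Aoki1983] N. Aoki, *On some arithmetic problems related to the Hodge cycles on the Fermat varieties*, Math. Ann. 266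
  (1983) 23–54 — Thm. C p. 47 (§9), Prop. 2.2 (level change), Thm. D.
* [AokiShioda1983] N. Aoki, T. Shioda, *Generators of the Néron–Severi group of a Fermat surface*, Progr. Math. 35 (1983)
  1–12 — §2 Thm. (𝔅²ₘ) (ii) a), b), c).
* [Shioda1982PicardFermat] T. Shioda, *On the Picard number of a Fermat surface*, J. Fac. Sci. Univ. Tokyo IA 28 (1982)
  725–734 — §2 p. 726 (`𝔍²ₘ(d) ≅ 𝔍²_{m/d}(1)`, decomposable elements), Lemma 1 (a), (b) p. 728, Prop. 4 (Q′) p. 729.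
* [MeyerNeutsch1981Fermatquadrupel] W. Meyer, W. Neutsch, *Fermatquadrupel*, Math. Ann. 256 (1981) 51–62 — Tabelle 1 p. 54.
* [Shioda1979PJA] T. Shioda, Proc. Japan Acad. 55A (1979) 111–114, §1 (2), (3) (the Hodge condition `IsHodgeMultiset`).
-/

namespace Literature.AlgebraicGeometry.Shioda1982

open Finset Multiset
open Literature.AlgebraicGeometry.HodgeTheory Literature.AlgebraicGeometry.HodgeTheory.FermatCharacter

/-! ## The vocabulary of the induction -/


/-- **Standard multisets** of a level `L` (any parameter `x`, units or not): Shioda's `α_x = (x, x + L/2, −2x, L/2)`,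
`β_x = (x, x + L/2, L/2 + 2x, −4x)` (`2 ∣ L`) and `γ_x = (x, x + L/3, x + 2L/3, −3x)` (`3 ∣ L`) as multisets — the
indecomposable elements of `𝔅²_L` predicted by [AokiShioda1983, Thm. (𝔅²ₘ) (ii)] together with their imprimitive multiples
(`𝔍²_L(d) ≅ 𝔍²_{L/d}(1)`, [Shioda1982PicardFermat, §2]). [cite: Shioda1982PicardFermat, Lemma 1 (a), (b) p. 728; §2 p. 726]
[cite: AokiShioda1983, Thm. (𝔅²ₘ) (ii) a), b), c)] -/
def IsStdMultiset (L : ℕ) (s : Multiset (ZMod L)) : Prop :=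
  ∃ x : ZMod L,
    (2 ∣ L ∧ (s = {x, x + ((L / 2 : ℕ) : ZMod L), -(2 * x), ((L / 2 : ℕ) : ZMod L)} ∨
      s = {x, x + ((L / 2 : ℕ) : ZMod L), 2 * x + ((L / 2 : ℕ) : ZMod L), -(4 * x)})) ∨
    (3 ∣ L ∧ s = {x, x + ((L / 3 : ℕ) : ZMod L), x + 2 * ((L / 3 : ℕ) : ZMod L), -(3 * x)})

/-- **Lift from a level `≤ 72`**: all members of `s` are divisible by a divisor `d` of `L` with `L/d ≤ 72` — `s` is the
multiple `(d)·s′` of a multiset `s′` of the level `L/d ≤ 72` (`𝔍²_L(d) ≅ 𝔍²_{L/d}(1)`, [Shioda1982PicardFermat, §2]); `d = 1` is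
allowed, so that at a level `L ≤ 72` every multiset qualifies, while at a level `L > 72` such an `s` is imprimitive. The levels
`≤ 72` are where [MeyerNeutsch1981Fermatquadrupel, Tabelle 1] has its exceptional rows among the `2ᵃ3ᵇ` (`12, 18, 24, 36, 48, 72`).
[cite: Shioda1982PicardFermat, §2 p. 726 (𝔍²ₘ(d))] [cite: MeyerNeutsch1981Fermatquadrupel, Tabelle 1 p. 54] -/
def IsSmallLift (L : ℕ) (s : Multiset (ZMod L)) : Prop :=
  ∃ d : ℕ, d ∣ L ∧ L ≤ 72 * d ∧ ∀ a ∈ s, d ∣ a.val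

section Step

variable {m N : ℕ} [NeZero m] [NeZero N]

/-! ### The doubling map `ℤ/N → ℤ/2N` -/

/-- The doubling map `t ↦ 2t` from `ℤ/N` to `ℤ/m`, `m = 2N` (on representatives). [folklore] -/
private def dbl (m : ℕ) (t : ZMod N) : ZMod m := ((2 * t.val : ℕ) : ZMod m)

omit [NeZero m] in
/-- `dbl` is additive (`m = 2N`). [folklore] -/
private theorem dbl_add (hmN : m = 2 * N) (a b : ZMod N) : dbl m (a + b) = dbl m a + dbl m b := by
  have key : ∃ c : ℕ, 2 * a.val + 2 * b.val = 2 * (a + b).val + m * c := by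
    by_cases h : a.val + b.val < N
    · exact ⟨0, by rw [ZMod.val_add_of_lt h]; ring⟩
    · refine ⟨1, ?_⟩
      have e := ZMod.val_add_val_of_le (not_lt.mp h)
      rw [hmN]
      omega
  obtain ⟨c, hc⟩ := key
  have := congrArg (Nat.cast : ℕ → ZMod m) hc
  rw [Nat.cast_add, Nat.cast_add, Nat.cast_mul ((m : ℕ)), ZMod.natCast_self, zero_mul, add_zero] at this
  unfold dbl
  rw [this]

omit [NeZero m] [NeZero N] in
/-- `dbl 0 = 0`. [folklore] -/
private theorem dbl_zero : dbl m (0 : ZMod N) = 0 := by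
  simp [dbl]

omit [NeZero m] in
/-- `dbl (−a) = −dbl a`. [folklore] -/
private theorem dbl_neg (hmN : m = 2 * N) (a : ZMod N) : dbl m (-a) = -dbl m a :=
  eq_neg_of_add_eq_zero_left (by rw [← dbl_add hmN, neg_add_cancel, dbl_zero])

omit [NeZero m] in
/-- `dbl (2a) = 2 dbl a`. [folklore] -/
private theorem dbl_two_mul (hmN : m = 2 * N) (a : ZMod N) : dbl m (2 * a) = 2 * dbl m a := by
  rw [two_mul a, dbl_add hmN, two_mul (dbl m a)]

omit [NeZero m] in
/-- `dbl (3a) = 3 dbl a`. [folklore] -/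
private theorem dbl_three_mul (hmN : m = 2 * N) (a : ZMod N) : dbl m (3 * a) = 3 * dbl m a := by
  rw [show (3 : ZMod N) * a = 2 * a + a by ring, dbl_add hmN, dbl_two_mul hmN]
  ring

omit [NeZero m] in
/-- `dbl (4a) = 4 dbl a`. [folklore] -/
private theorem dbl_four_mul (hmN : m = 2 * N) (a : ZMod N) : dbl m (4 * a) = 4 * dbl m a := by
  rw [show (4 : ZMod N) * a = 2 * a + 2 * a by ring, dbl_add hmN, dbl_two_mul hmN]
  ring

omit [NeZero m] in
/-- The representative of `dbl t` is `2⟨t⟩` (`m = 2N`). [folklore] -/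
private theorem val_dbl (hmN : m = 2 * N) (t : ZMod N) : (dbl m t).val = 2 * t.val := by
  unfold dbl
  rw [ZMod.val_natCast, Nat.mod_eq_of_lt (by have := ZMod.val_lt t; omega)]

omit [NeZero N] in
/-- The reduction `ℤ/m → ℤ/N` on representatives. [folklore] -/
private theorem val_castHom' (hNm : N ∣ m) (y : ZMod m) : (ZMod.castHom hNm (ZMod N) y).val = y.val % N := by
  rw [ZMod.castHom_apply, ZMod.cast_eq_val, ZMod.val_natCast]

omit [NeZero N] in
/-- `dbl (y mod N) = 2y` (`m = 2N`). [folklore] -/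
private theorem dbl_castHom (hmN : m = 2 * N) (hNm : N ∣ m) (y : ZMod m) :
    dbl m (ZMod.castHom hNm (ZMod N) y) = 2 * y := by
  unfold dbl
  rw [val_castHom']
  have key : ∃ c : ℕ, 2 * y.val = 2 * (y.val % N) + m * c := by
    have hlt := ZMod.val_lt y
    by_cases h : y.val < N
    · exact ⟨0, by rw [Nat.mod_eq_of_lt h]; ring⟩
    · refine ⟨1, ?_⟩
      rw [Nat.mod_eq_sub_mod (not_lt.mp h), Nat.mod_eq_of_lt (by omega)]
      omega
  obtain ⟨c, hc⟩ := key
  have := congrArg (Nat.cast : ℕ → ZMod m) hc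
  rw [Nat.cast_add, Nat.cast_mul ((m : ℕ)), ZMod.natCast_self, zero_mul, add_zero, Nat.cast_mul, Nat.cast_ofNat,
    ZMod.natCast_zmod_val] at this
  rw [← this]

/-- Half the representative: `⟨w⟩/2` as a residue modulo `m` (for even `w`, `2 · half w = w`). [folklore] -/
private def half (w : ZMod m) : ZMod m := ((w.val / 2 : ℕ) : ZMod m)

/-- `2 · (⟨w⟩/2) = w` for even `w`. [folklore] -/
private theorem two_mul_half {w : ZMod m} (hw : 2 ∣ w.val) : (2 : ZMod m) * half w = w := by
  obtain ⟨c, hc⟩ := hw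
  have e : (((2 * (w.val / 2) : ℕ)) : ZMod m) = w := by rw [hc, Nat.mul_div_cancel_left _ two_pos, ← hc, ZMod.natCast_zmod_val]
  calc (2 : ZMod m) * half w = (((2 * (w.val / 2) : ℕ)) : ZMod m) := by unfold half; push_cast; ring
    _ = w := e

omit [NeZero N] in
/-- `dbl ((w/2) mod N) = w` for even `w`. [folklore] -/
private theorem dbl_castHom_half (hmN : m = 2 * N) (hNm : N ∣ m) {w : ZMod m} (hw : 2 ∣ w.val) :
    dbl m (ZMod.castHom hNm (ZMod N) (half w)) = w := by
  rw [dbl_castHom hmN hNm, two_mul_half hw]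

omit [NeZero m] in
/-- `dbl` is injective (`m = 2N`). [folklore] -/
private theorem dbl_injective (hmN : m = 2 * N) : Function.Injective (dbl m : ZMod N → ZMod m) := by
  intro a b h
  have := congrArg ZMod.val h
  rw [val_dbl hmN, val_dbl hmN] at this
  exact ZMod.val_injective N (by omega)

omit [NeZero m] in
/-- `dbl` of a sum. [folklore] -/
private theorem dbl_multisetSum (hmN : m = 2 * N) (t : Multiset (ZMod N)) : dbl m t.sum = (t.map (dbl m)).sum := by
  induction t using Multiset.induction with
  | empty => simp only [Multiset.sum_zero, Multiset.map_zero]; exact dbl_zero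
  | cons a u ih => rw [Multiset.sum_cons, Multiset.map_cons, Multiset.sum_cons, dbl_add hmN, ih]

omit [NeZero m] in
/-- `dbl (N/2) = N = m/2` and `dbl (N/3) = m/3` (`m = 2N`, `2 ∣ N`, `3 ∣ N`). [folklore] -/
private theorem dbl_half_third (hmN : m = 2 * N) (h2 : 2 ∣ N) (h3 : 3 ∣ N) :
    dbl m (((N / 2 : ℕ)) : ZMod N) = ((m / 2 : ℕ) : ZMod m) ∧ dbl m (((N / 3 : ℕ)) : ZMod N) = ((m / 3 : ℕ) : ZMod m) := by
  have hN0 := NeZero.pos N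
  constructor
  · unfold dbl
    rw [ZMod.val_natCast, Nat.mod_eq_of_lt (Nat.div_lt_self hN0 one_lt_two), Nat.mul_div_cancel_left' h2, hmN,
      Nat.mul_div_cancel_left _ two_pos]
  · unfold dbl
    rw [ZMod.val_natCast, Nat.mod_eq_of_lt (Nat.div_lt_self hN0 (by norm_num))]
    congr 1
    obtain ⟨c, hc⟩ := h3
    rw [hc, Nat.mul_div_cancel_left _ three_pos, hmN, hc, show 2 * (3 * c) = 3 * (2 * c) by ring,
      Nat.mul_div_cancel_left _ three_pos]

omit [NeZero m] in
/-- **Doubling a standard multiset of level `N` gives a standard multiset of level `2N`** (`2, 3 ∣ N`): `2·α_x = α_{2x}`,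
`2·β_x = β_{2x}`, `2·γ_x = γ_{2x}`. [cite: Shioda1982PicardFermat, §2 p. 726 (𝔍²ₘ(d) ≅ 𝔍²_{m/d}(1))] -/
theorem isStdMultiset_map_dbl (hmN : m = 2 * N) (h2 : 2 ∣ N) (h3 : 3 ∣ N) {t : Multiset (ZMod N)} (ht : IsStdMultiset N t) :
    IsStdMultiset m (t.map (dbl m)) := by
  obtain ⟨hH, hR⟩ := dbl_half_third hmN h2 h3
  have h2m : 2 ∣ m := ⟨N, hmN⟩
  have h3m : 3 ∣ m := Nat.dvd_trans h3 ⟨2, by rw [hmN]; ring⟩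
  obtain ⟨x, ⟨-, hab⟩ | ⟨-, hc⟩⟩ := ht
  · refine ⟨dbl m x, Or.inl ⟨h2m, ?_⟩⟩
    rcases hab with e | e <;> [left; right] <;> rw [e] <;>
      simp only [Multiset.insert_eq_cons, Multiset.map_cons, Multiset.map_singleton, dbl_add hmN, dbl_neg hmN, hH,
        dbl_two_mul hmN, dbl_four_mul hmN]
  · refine ⟨dbl m x, Or.inr ⟨h3m, ?_⟩⟩
    rw [hc]
    simp only [Multiset.insert_eq_cons, Multiset.map_cons, Multiset.map_singleton, dbl_add hmN, dbl_neg hmN, hR,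
      dbl_two_mul hmN, dbl_three_mul hmN]

omit [NeZero m] in
/-- **Doubling a lift from a level `≤ 72` gives one** (`m = 2N`: the divisor doubles; `𝔍²ₘ(d) ≅ 𝔍²_{m/d}(1)`).
[cite: Shioda1982PicardFermat, §2 p. 726 (𝔍²ₘ(d) ≅ 𝔍²_{m/d}(1))] -/
theorem isSmallLift_map_dbl (hmN : m = 2 * N) {t : Multiset (ZMod N)} (ht : IsSmallLift N t) :
    IsSmallLift m (t.map (dbl m)) := by
  obtain ⟨d, hdN, hle, hdt⟩ := ht
  refine ⟨2 * d, by rw [hmN]; exact Nat.mul_dvd_mul_left 2 hdN, by rw [hmN]; omega, fun a ha ↦ ?_⟩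
  obtain ⟨b, hb, rfl⟩ := Multiset.mem_map.mp ha
  rw [val_dbl hmN]
  exact Nat.mul_dvd_mul_left 2 (hdt b hb)

/-! ### The transfer `2N → N` at a variable level -/

omit [NeZero N] in
/-- The norm sum of `k • u` is `k` times that of `u`. [folklore] -/
private theorem mNormSum_nsmul' (k : ℕ) (u : Multiset (ZMod N)) : mNormSum (k • u) = k * mNormSum u := by
  simp only [mNormSum, Multiset.map_nsmul, Multiset.sum_nsmul, smul_eq_mul]

omit [NeZero m] in
/-- `FermatCharacter.isHodgeMultiset_transfer_two` at a level `m = 2N` given by an equation. [cite: Aoki1983, Prop. 2.2] -/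
private theorem transfer_two' (hmN : m = 2 * N) (h2 : 2 ∣ N) (hNm : N ∣ m) {s₁ s₀ : Multiset (ZMod m)}
    (h₁ : ∀ w ∈ s₁, w.val % 2 = 1) (h₀ : ∀ w ∈ s₀, w.val % 2 = 0) (hs : IsHodgeMultiset (s₁ + s₀)) :
    IsHodgeMultiset (s₁.map (ZMod.castHom hNm (ZMod N)) + 2 • s₀.map fun w ↦ ZMod.castHom hNm (ZMod N) (half w)) := by
  subst hmN
  exact isHodgeMultiset_transfer_two h2 hNm h₁ h₀ hs

/-! ### Case: all members even — halve and use the classification at level `N` -/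

/-- **All members even.** Let `m = 2N` with `2, 3 ∣ N`, and let `s` be a pair-free Hodge `4`-multiset over `ℤ/m` all of whose
members are even. If every pair-free Hodge `4`-multiset over `ℤ/N` is standard or a lift from a level `≤ 72` (`IH`), then so is `s`:
`s = 2·s′` with `s′ = (s/2 mod N)` a pair-free Hodge quadruple of level `N` (its norm equations are halves of those of `s`,
[Shioda1982PicardFermat, §2]), and doubling preserves both alternatives. [cite: Shioda1982PicardFermat, §2 p. 726, Prop. 4 (Q′)] -/
theorem std_or_small_of_all_even (hmN : m = 2 * N) (h2 : 2 ∣ N) (h3 : 3 ∣ N)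
    (IH : ∀ t : Multiset (ZMod N), IsHodgeMultiset t → card t = 4 → ¬ HasPair t → IsStdMultiset N t ∨ IsSmallLift N t)
    {s : Multiset (ZMod m)} (hs : IsHodgeMultiset s) (hcard : card s = 4) (hpf : ¬ HasPair s)
    (heven : ∀ a ∈ s, 2 ∣ a.val) : IsStdMultiset m s ∨ IsSmallLift m s := by
  classical
  have hNm : N ∣ m := ⟨2, by rw [hmN]; ring⟩
  set R := ZMod.castHom hNm (ZMod N) with hR
  set t : Multiset (ZMod N) := s.map fun w ↦ R (half w) with ht
  -- `s = dbl (t)`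
  have hst : s = t.map (dbl m) := by
    rw [ht, Multiset.map_map]
    conv_lhs => rw [← Multiset.map_id s]
    refine Multiset.map_congr rfl fun w hw ↦ ?_
    simp only [Function.comp_apply, id]
    rw [dbl_castHom_half hmN hNm (heven w hw)]
  -- `2•t` is Hodge by the transfer; hence `t` is
  have hT : IsHodgeMultiset ((0 : Multiset (ZMod m)).map R + 2 • t) :=
    transfer_two' hmN h2 hNm (s₁ := 0) (s₀ := s) (by simp) (fun w hw ↦ Nat.mod_eq_zero_of_dvd (heven w hw))
      (by rw [zero_add]; exact hs)
  rw [Multiset.map_zero, zero_add] at hT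
  have htH : IsHodgeMultiset t := by
    obtain ⟨⟨hne, -⟩, hnorm⟩ := hT
    refine ⟨⟨fun a ha ↦ hne a (by rw [two_nsmul]; exact Multiset.mem_add.mpr (Or.inl ha)), ?_⟩, fun v ↦ ?_⟩
    · -- the sum: `dbl` is injective and additive, `dbl (Σ t) = Σ s = 0`
      have e : dbl m t.sum = s.sum := by rw [hst, dbl_multisetSum hmN]
      rw [hs.1.2] at e
      exact dbl_injective hmN (by rw [e, dbl_zero])
    · have h := hnorm v
      rw [Multiset.map_nsmul, mNormSum_nsmul', Multiset.card_nsmul, Nat.mul_left_comm N 2] at h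
      clear_value R t
      omega
  have htc : card t = 4 := by rw [ht, Multiset.card_map, hcard]
  have htpf : ¬ HasPair t := by
    rintro ⟨a, ha, hna⟩
    apply hpf
    refine ⟨dbl m a, by rw [hst]; exact Multiset.mem_map_of_mem _ ha, ?_⟩
    rw [hst, ← dbl_neg hmN, ← Multiset.map_erase _ (dbl_injective hmN)]
    exact Multiset.mem_map_of_mem _ hna
  rcases IH t htH htc htpf with hstd | hsm
  · exact Or.inl (hst ▸ isStdMultiset_map_dbl hmN h2 h3 hstd)
  · exact Or.inr (hst ▸ isSmallLift_map_dbl hmN hsm)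


/-! ### The tripling map `ℤ/N → ℤ/3N` -/

/-- The tripling map `t ↦ 3t` from `ℤ/N` to `ℤ/m`, `m = 3N` (on representatives). [folklore] -/
private def tpl (m : ℕ) (t : ZMod N) : ZMod m := ((3 * t.val : ℕ) : ZMod m)

omit [NeZero m] in
/-- `tpl` is additive (`m = 3N`). [folklore] -/
private theorem tpl_add (hmN : m = 3 * N) (a b : ZMod N) : tpl m (a + b) = tpl m a + tpl m b := by
  have key : ∃ c : ℕ, 3 * a.val + 3 * b.val = 3 * (a + b).val + m * c := by
    by_cases h : a.val + b.val < N
    · exact ⟨0, by rw [ZMod.val_add_of_lt h]; ring⟩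
    · refine ⟨1, ?_⟩
      have e := ZMod.val_add_val_of_le (not_lt.mp h)
      rw [hmN]
      omega
  obtain ⟨c, hc⟩ := key
  have := congrArg (Nat.cast : ℕ → ZMod m) hc
  rw [Nat.cast_add, Nat.cast_add, Nat.cast_mul ((m : ℕ)), ZMod.natCast_self, zero_mul, add_zero] at this
  unfold tpl
  rw [this]

omit [NeZero m] [NeZero N] in
/-- `tpl 0 = 0`. [folklore] -/
private theorem tpl_zero : tpl m (0 : ZMod N) = 0 := by
  simp [tpl]

omit [NeZero m] in
/-- `tpl (−a) = −tpl a`. [folklore] -/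
private theorem tpl_neg (hmN : m = 3 * N) (a : ZMod N) : tpl m (-a) = -tpl m a :=
  eq_neg_of_add_eq_zero_left (by rw [← tpl_add hmN, neg_add_cancel, tpl_zero])

omit [NeZero m] in
/-- `tpl (2a) = 2 tpl a`. [folklore] -/
private theorem tpl_two_mul (hmN : m = 3 * N) (a : ZMod N) : tpl m (2 * a) = 2 * tpl m a := by
  rw [two_mul a, tpl_add hmN, two_mul (tpl m a)]

omit [NeZero m] in
/-- `tpl (3a) = 3 tpl a`. [folklore] -/
private theorem tpl_three_mul (hmN : m = 3 * N) (a : ZMod N) : tpl m (3 * a) = 3 * tpl m a := by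
  rw [show (3 : ZMod N) * a = 2 * a + a by ring, tpl_add hmN, tpl_two_mul hmN]
  ring

omit [NeZero m] in
/-- `tpl (4a) = 4 tpl a`. [folklore] -/
private theorem tpl_four_mul (hmN : m = 3 * N) (a : ZMod N) : tpl m (4 * a) = 4 * tpl m a := by
  rw [show (4 : ZMod N) * a = 2 * a + 2 * a by ring, tpl_add hmN, tpl_two_mul hmN]
  ring

omit [NeZero m] in
/-- The representative of `tpl t` is `3⟨t⟩` (`m = 3N`). [folklore] -/
private theorem val_tpl (hmN : m = 3 * N) (t : ZMod N) : (tpl m t).val = 3 * t.val := by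
  unfold tpl
  rw [ZMod.val_natCast, Nat.mod_eq_of_lt (by have := ZMod.val_lt t; omega)]

/-- A third of the representative: `⟨w⟩/3` as a residue modulo `m` (for `3 ∣ ⟨w⟩`, `3 · third w = w`). [folklore] -/
private def third (w : ZMod m) : ZMod m := ((w.val / 3 : ℕ) : ZMod m)

/-- `3 · (⟨w⟩/3) = w` for `3 ∣ ⟨w⟩`. [folklore] -/
private theorem three_mul_third {w : ZMod m} (hw : 3 ∣ w.val) : (3 : ZMod m) * third w = w := by
  obtain ⟨c, hc⟩ := hw
  have e : (((3 * (w.val / 3) : ℕ)) : ZMod m) = w := by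
    rw [hc, Nat.mul_div_cancel_left _ three_pos, ← hc, ZMod.natCast_zmod_val]
  calc (3 : ZMod m) * third w = (((3 * (w.val / 3) : ℕ)) : ZMod m) := by unfold third; push_cast; ring
    _ = w := e

omit [NeZero N] in
/-- `tpl (y mod N) = 3y` (`m = 3N`). [folklore] -/
private theorem tpl_castHom (hmN : m = 3 * N) (hNm : N ∣ m) (y : ZMod m) :
    tpl m (ZMod.castHom hNm (ZMod N) y) = 3 * y := by
  unfold tpl
  rw [val_castHom']
  have key : ∃ c : ℕ, 3 * y.val = 3 * (y.val % N) + m * c := by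
    refine ⟨y.val / N, ?_⟩
    have e1 := Nat.div_add_mod y.val N
    have e2 : m * (y.val / N) = 3 * (N * (y.val / N)) := by generalize y.val / N = c; subst hmN; ring
    omega
  obtain ⟨c, hc⟩ := key
  have := congrArg (Nat.cast : ℕ → ZMod m) hc
  rw [Nat.cast_add, Nat.cast_mul ((m : ℕ)), ZMod.natCast_self, zero_mul, add_zero, Nat.cast_mul, Nat.cast_ofNat,
    ZMod.natCast_zmod_val] at this
  rw [← this]

omit [NeZero N] in
/-- `tpl ((w/3) mod N) = w` for `3 ∣ ⟨w⟩`. [folklore] -/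
private theorem tpl_castHom_third (hmN : m = 3 * N) (hNm : N ∣ m) {w : ZMod m} (hw : 3 ∣ w.val) :
    tpl m (ZMod.castHom hNm (ZMod N) (third w)) = w := by
  rw [tpl_castHom hmN hNm, three_mul_third hw]

omit [NeZero m] in
/-- `tpl` is injective (`m = 3N`). [folklore] -/
private theorem tpl_injective (hmN : m = 3 * N) : Function.Injective (tpl m : ZMod N → ZMod m) := by
  intro a b h
  have := congrArg ZMod.val h
  rw [val_tpl hmN, val_tpl hmN] at this
  exact ZMod.val_injective N (by omega)

omit [NeZero m] in
/-- `tpl` of a sum. [folklore] -/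
private theorem tpl_multisetSum (hmN : m = 3 * N) (t : Multiset (ZMod N)) : tpl m t.sum = (t.map (tpl m)).sum := by
  induction t using Multiset.induction with
  | empty => simp only [Multiset.sum_zero, Multiset.map_zero]; exact tpl_zero
  | cons a u ih => rw [Multiset.sum_cons, Multiset.map_cons, Multiset.sum_cons, tpl_add hmN, ih]

omit [NeZero m] in
/-- `tpl (N/2) = m/2` and `tpl (N/3) = N = m/3` (`m = 3N`, `2 ∣ N`, `3 ∣ N`). [folklore] -/
private theorem tpl_half_third (hmN : m = 3 * N) (h2 : 2 ∣ N) (h3 : 3 ∣ N) :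
    tpl m (((N / 2 : ℕ)) : ZMod N) = ((m / 2 : ℕ) : ZMod m) ∧ tpl m (((N / 3 : ℕ)) : ZMod N) = ((m / 3 : ℕ) : ZMod m) := by
  have hN0 := NeZero.pos N
  constructor
  · unfold tpl
    rw [ZMod.val_natCast, Nat.mod_eq_of_lt (Nat.div_lt_self hN0 one_lt_two)]
    congr 1
    obtain ⟨c, hc⟩ := h2
    rw [hc, Nat.mul_div_cancel_left _ two_pos, hmN, hc, show 3 * (2 * c) = 2 * (3 * c) by ring,
      Nat.mul_div_cancel_left _ two_pos]
  · unfold tpl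
    rw [ZMod.val_natCast, Nat.mod_eq_of_lt (Nat.div_lt_self hN0 (by norm_num)), Nat.mul_div_cancel_left' h3, hmN,
      Nat.mul_div_cancel_left _ three_pos]

omit [NeZero m] in
/-- **Tripling a standard multiset of level `N` gives a standard multiset of level `3N`** (`2, 3 ∣ N`): `3·α_x = α_{3x}`,
`3·β_x = β_{3x}`, `3·γ_x = γ_{3x}`. [cite: Shioda1982PicardFermat, §2 p. 726 (𝔍²ₘ(d) ≅ 𝔍²_{m/d}(1))] -/
theorem isStdMultiset_map_tpl (hmN : m = 3 * N) (h2 : 2 ∣ N) (h3 : 3 ∣ N) {t : Multiset (ZMod N)} (ht : IsStdMultiset N t) :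
    IsStdMultiset m (t.map (tpl m)) := by
  obtain ⟨hH, hR⟩ := tpl_half_third hmN h2 h3
  have h2m : 2 ∣ m := Nat.dvd_trans h2 ⟨3, by rw [hmN]; ring⟩
  have h3m : 3 ∣ m := ⟨N, hmN⟩
  obtain ⟨x, ⟨-, hab⟩ | ⟨-, hc⟩⟩ := ht
  · refine ⟨tpl m x, Or.inl ⟨h2m, ?_⟩⟩
    rcases hab with e | e <;> [left; right] <;> rw [e] <;>
      simp only [Multiset.insert_eq_cons, Multiset.map_cons, Multiset.map_singleton, tpl_add hmN, tpl_neg hmN, hH,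
        tpl_two_mul hmN, tpl_four_mul hmN]
  · refine ⟨tpl m x, Or.inr ⟨h3m, ?_⟩⟩
    rw [hc]
    simp only [Multiset.insert_eq_cons, Multiset.map_cons, Multiset.map_singleton, tpl_add hmN, tpl_neg hmN, hR,
      tpl_two_mul hmN, tpl_three_mul hmN]

omit [NeZero m] in
/-- **Tripling a lift from a level `≤ 72` gives one** (`m = 3N`: the divisor triples; `𝔍²ₘ(d) ≅ 𝔍²_{m/d}(1)`).
[cite: Shioda1982PicardFermat, §2 p. 726 (𝔍²ₘ(d) ≅ 𝔍²_{m/d}(1))] -/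
theorem isSmallLift_map_tpl (hmN : m = 3 * N) {t : Multiset (ZMod N)} (ht : IsSmallLift N t) :
    IsSmallLift m (t.map (tpl m)) := by
  obtain ⟨d, hdN, hle, hdt⟩ := ht
  refine ⟨3 * d, by rw [hmN]; exact Nat.mul_dvd_mul_left 3 hdN, by rw [hmN]; omega, fun a ha ↦ ?_⟩
  obtain ⟨b, hb, rfl⟩ := Multiset.mem_map.mp ha
  rw [val_tpl hmN]
  exact Nat.mul_dvd_mul_left 3 (hdt b hb)

/-! ### The transfer `3N → N` at a variable level -/

omit [NeZero m] in
/-- `FermatCharacter.isHodgeMultiset_transfer_three` at a level `m = 3N` given by an equation. [cite: Aoki1983, Prop. 2.2] -/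
private theorem transfer_three' (hmN : m = 3 * N) (h3 : 3 ∣ N) (hNm : N ∣ m) {s₁ s₀ : Multiset (ZMod m)}
    (h₁ : ∀ w ∈ s₁, w.val % 3 ≠ 0) (h₀ : ∀ w ∈ s₀, w.val % 3 = 0) (hs : IsHodgeMultiset (s₁ + s₀)) :
    IsHodgeMultiset (s₁.map (ZMod.castHom hNm (ZMod N)) + 3 • s₀.map fun w ↦ ZMod.castHom hNm (ZMod N) (third w)) := by
  subst hmN
  exact isHodgeMultiset_transfer_three h3 hNm h₁ h₀ hs

/-! ### Case: all members divisible by `3` — divide by `3` and use the classification at level `N = m/3` -/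

/-- **All members divisible by `3`.** Let `m = 3N` with `2, 3 ∣ N`, and let `s` be a pair-free Hodge `4`-multiset over `ℤ/m`
all of whose members have representative divisible by `3`. If every pair-free Hodge `4`-multiset over `ℤ/N` is standard or a
lift from a level `≤ 72` (`IH`), then so is `s`: `s = 3·s′` with `s′ = (s/3 mod N)` a pair-free Hodge quadruple of level `N`
([Shioda1982PicardFermat, §2], via the transfer `3N → N` of [Aoki1983, Prop. 2.2]), and tripling preserves both alternatives.
[cite: Shioda1982PicardFermat, §2 p. 726, Prop. 4 (Q′)] [cite: Aoki1983, Prop. 2.2] -/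
theorem std_or_small_of_all_three (hmN : m = 3 * N) (h2 : 2 ∣ N) (h3 : 3 ∣ N)
    (IH : ∀ t : Multiset (ZMod N), IsHodgeMultiset t → card t = 4 → ¬ HasPair t → IsStdMultiset N t ∨ IsSmallLift N t)
    {s : Multiset (ZMod m)} (hs : IsHodgeMultiset s) (hcard : card s = 4) (hpf : ¬ HasPair s)
    (hthree : ∀ a ∈ s, 3 ∣ a.val) : IsStdMultiset m s ∨ IsSmallLift m s := by
  classical
  have hNm : N ∣ m := ⟨3, by rw [hmN]; ring⟩
  set R := ZMod.castHom hNm (ZMod N) with hR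
  set t : Multiset (ZMod N) := s.map fun w ↦ R (third w) with ht
  -- `s = tpl (t)`
  have hst : s = t.map (tpl m) := by
    rw [ht, Multiset.map_map]
    conv_lhs => rw [← Multiset.map_id s]
    refine Multiset.map_congr rfl fun w hw ↦ ?_
    simp only [Function.comp_apply, id]
    rw [tpl_castHom_third hmN hNm (hthree w hw)]
  -- `3•t` is Hodge by the transfer; hence `t` is
  have hT : IsHodgeMultiset ((0 : Multiset (ZMod m)).map R + 3 • t) :=
    transfer_three' hmN h3 hNm (s₁ := 0) (s₀ := s) (by simp) (fun w hw ↦ Nat.mod_eq_zero_of_dvd (hthree w hw))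
      (by rw [zero_add]; exact hs)
  rw [Multiset.map_zero, zero_add] at hT
  have htH : IsHodgeMultiset t := by
    obtain ⟨⟨hne, -⟩, hnorm⟩ := hT
    refine ⟨⟨fun a ha ↦ hne a (Multiset.mem_nsmul.mpr ⟨by norm_num, ha⟩), ?_⟩, fun v ↦ ?_⟩
    · have e : tpl m t.sum = s.sum := by rw [hst, tpl_multisetSum hmN]
      rw [hs.1.2] at e
      exact tpl_injective hmN (by rw [e, tpl_zero])
    · have h := hnorm v
      rw [Multiset.map_nsmul, mNormSum_nsmul', Multiset.card_nsmul, Nat.mul_left_comm N 3] at h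
      clear_value R t
      omega
  have htc : card t = 4 := by rw [ht, Multiset.card_map, hcard]
  have htpf : ¬ HasPair t := by
    rintro ⟨a, ha, hna⟩
    apply hpf
    refine ⟨tpl m a, by rw [hst]; exact Multiset.mem_map_of_mem _ ha, ?_⟩
    rw [hst, ← tpl_neg hmN, ← Multiset.map_erase _ (tpl_injective hmN)]
    exact Multiset.mem_map_of_mem _ hna
  rcases IH t htH htc htpf with hstd | hsm
  · exact Or.inl (hst ▸ isStdMultiset_map_tpl hmN h2 h3 hstd)
  · exact Or.inr (hst ▸ isSmallLift_map_tpl hmN hsm)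

/-! ### Level `N = 2K`: the element `K = N/2` and the equation `2c = 0` -/

/-- In `ℤ/L`, `L = 2K`: `2x = 0` forces `x ∈ {0, K}`. [folklore] -/
private theorem eq_zero_or_eq_half {L K : ℕ} [NeZero L] (hL : L = 2 * K) {x : ZMod L} (h : (2 : ZMod L) * x = 0) :
    x = 0 ∨ x = ((K : ℕ) : ZMod L) := by
  have hx := ZMod.val_lt x
  have hdiv : L ∣ 2 * x.val := by
    rw [← ZMod.natCast_eq_zero_iff, Nat.cast_mul, Nat.cast_ofNat, ZMod.natCast_zmod_val, h]
  obtain ⟨c, hc⟩ := hdiv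
  have hc2 : c < 2 := by
    by_contra hc2
    have : 2 * L ≤ L * c := by nlinarith
    omega
  interval_cases c
  · left
    apply ZMod.val_injective L
    rw [ZMod.val_zero]; omega
  · right
    apply ZMod.val_injective L
    rw [ZMod.val_natCast, Nat.mod_eq_of_lt (by omega)]
    omega

/-- `⟨K⟩ = K` at level `L = 2K`, `K > 0`. [folklore] -/
private theorem val_half {L K : ℕ} [NeZero L] (hL : L = 2 * K) : (((K : ℕ) : ZMod L)).val = K := by
  rw [ZMod.val_natCast, Nat.mod_eq_of_lt (by have := NeZero.pos L; omega)]

/-- `−K = K` at level `2K`. [folklore] -/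
private theorem neg_half {L K : ℕ} (hL : L = 2 * K) : -((K : ℕ) : ZMod L) = ((K : ℕ) : ZMod L) := by
  have e : (((K : ℕ) : ZMod L)) + ((K : ℕ) : ZMod L) = ((L : ℕ) : ZMod L) := by rw [hL]; push_cast; ring
  rw [ZMod.natCast_self] at e
  linear_combination -e

/-- A unit of `ℤ/2K` is odd, so `v · K = K`. [cite: Shioda1982PicardFermat, Lemma 1 (a) p. 728 (the entry m′ of αᵢ is fixed by the units)] -/
private theorem unit_mul_half {L K : ℕ} [NeZero L] (hL : L = 2 * K) (v : (ZMod L)ˣ) :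
    (v : ZMod L) * ((K : ℕ) : ZMod L) = ((K : ℕ) : ZMod L) := by
  have hcop := ZMod.val_coe_unit_coprime v
  have hodd : ¬ 2 ∣ (v : ZMod L).val := fun h2 ↦ by
    have := Nat.dvd_gcd h2 (show 2 ∣ L from ⟨K, hL⟩)
    rw [Nat.Coprime.gcd_eq_one hcop] at this
    omega
  obtain ⟨c, hc⟩ : ∃ c, (v : ZMod L).val = 2 * c + 1 := ⟨(v : ZMod L).val / 2, by omega⟩
  have e : (v : ZMod L) = (((2 * c + 1 : ℕ)) : ZMod L) := by rw [← hc, ZMod.natCast_zmod_val]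
  rw [e, show (((2 * c + 1 : ℕ)) : ZMod L) * ((K : ℕ) : ZMod L) = (c : ZMod L) * ((L : ℕ) : ZMod L) + K by
    rw [hL]; push_cast; ring, ZMod.natCast_self, mul_zero, zero_add]

/-! ### The twin transfer: a twinned pair `y, y + m/2` with two even companions, seen at level `N = m/2` -/

omit [NeZero N] in
/-- Parity of the reduction modulo `N` (`2 ∣ N`). [folklore] -/
private theorem val_castHom_mod_two (hNm : N ∣ m) (h2 : 2 ∣ N) (w : ZMod m) :
    (ZMod.castHom hNm (ZMod N) w).val % 2 = w.val % 2 := by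
  rw [val_castHom', Nat.mod_mod_of_dvd _ h2]

/-- The value of `half w`: `⟨half w⟩ = ⟨w⟩/2`. [folklore] -/
private theorem val_half_eq (w : ZMod m) : (half w).val = w.val / 2 := by
  unfold half
  rw [ZMod.val_natCast, Nat.mod_eq_of_lt (by have := ZMod.val_lt w; omega)]

omit [NeZero m] in
/-- `a ::ₘ b ::ₘ c ::ₘ {d} = {a, b, c} + {d}`. [folklore] -/
private theorem cons₃_singleton (a b c d : ZMod m) :
    (a ::ₘ b ::ₘ c ::ₘ ({d} : Multiset (ZMod m))) = (a ::ₘ b ::ₘ ({c} : Multiset (ZMod m))) + {d} := by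
  simp only [Multiset.singleton_add, Multiset.cons_add]

omit [NeZero m] in
/-- In `y ::ₘ y' ::ₘ z ::ₘ {w}`, erasing `z` leaves `w`. [folklore] -/
private theorem mem_erase_quad (y y' z w : ZMod m) : w ∈ (y ::ₘ y' ::ₘ z ::ₘ ({w} : Multiset (ZMod m))).erase z := by
  classical
  rw [Multiset.cons_swap y' z, Multiset.cons_swap y z, Multiset.erase_cons_head]
  simp

/-- **Reading an `α`-shape back at level `m`.** If `{2y, z, w} + {H} = {x′, x′ + H, −2x′} + {H}` as multisets over `ℤ/m`
(`m = 2N`, `H = N`, `y` odd, `x′` even), then `{z, w} = {2y + H, −4y}`. [folklore] -/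
private theorem pair_eq_of_alpha_shape (hmN : m = 2 * N) (h2 : 2 ∣ N) {y z w x' : ZMod m} (hy1 : y.val % 2 = 1)
    (hx'0 : x'.val % 2 = 0)
    (hHH : ((N : ℕ) : ZMod m) + ((N : ℕ) : ZMod m) = 0)
    (e' : ((2 : ZMod m) * y ::ₘ z ::ₘ w ::ₘ ({((N : ℕ) : ZMod m)} : Multiset (ZMod m))) =
      x' ::ₘ (x' + ((N : ℕ) : ZMod m)) ::ₘ (-(2 * x')) ::ₘ {((N : ℕ) : ZMod m)}) :
    z ::ₘ ({w} : Multiset (ZMod m)) = (2 * y + ((N : ℕ) : ZMod m)) ::ₘ {-(4 * y)} := by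
  set H : ZMod m := ((N : ℕ) : ZMod m) with hH
  have e3 : ((2 : ZMod m) * y ::ₘ z ::ₘ ({w} : Multiset (ZMod m))) = x' ::ₘ (x' + H) ::ₘ {-(2 * x')} := by
    rw [cons₃_singleton, cons₃_singleton] at e'
    exact add_right_cancel e'
  have mem : (2 : ZMod m) * y ∈ (x' ::ₘ (x' + H) ::ₘ ({-(2 * x')} : Multiset (ZMod m))) := by rw [← e3]; simp
  simp only [Multiset.mem_cons, Multiset.mem_singleton] at mem
  rcases mem with e4 | e4 | e4
  · rw [← e4, Multiset.cons_inj_right] at e3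
    rw [e3, show -(2 * (2 * y)) = -(4 * y) by ring]
  · have ex' : x' = 2 * y + H := by linear_combination -e4 - hHH
    rw [ex', show 2 * y + H + H = 2 * y by rw [add_assoc, hHH, add_zero], Multiset.cons_swap (2 * y + H) (2 * y),
      Multiset.cons_inj_right] at e3
    rw [e3, show -(2 * (2 * y + H)) = -(4 * y) by linear_combination -hHH]
  · exfalso
    have hh : (2 : ZMod m) * (y + x') = 0 := by linear_combination e4
    have hpar : (y + x').val % 2 = 1 := by
      rw [ZMod.val_add, Nat.mod_mod_of_dvd _ ⟨N, hmN⟩, Nat.add_mod, hy1, hx'0]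
    rcases eq_zero_or_eq_half hmN hh with h | h
    · rw [h, ZMod.val_zero] at hpar; omega
    · rw [h, ZMod.val_natCast, Nat.mod_eq_of_lt (show N < m by have := NeZero.pos N; omega)] at hpar
      obtain ⟨K, hK⟩ := h2
      omega

/-- **The twin transfer.** Let `m = 2N` with `6 ∣ N`, `4 ∣ N` or `9 ∣ N`, `N > 72`, and assume the classification at level `N`: every
pair-free Hodge `4`-multiset over `ℤ/N` is standard or a lift from a level `≤ 72` (`IH`). Let `s = {y, y + N, z, w}` be a
pair-free Hodge multiset over `ℤ/m` with `y` odd and `z, w` even. The transfer `2N → N` ([Aoki1983, Prop. 2.2]) makes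
`{ȳ, ȳ} + 2·{z/2, w/2}` Hodge at level `N`, hence `τ = {ȳ, z/2, w/2, N/2}` is a Hodge quadruple of level `N` (the device of
`PicardNumberTwoPowerPrime`, case of two odd members); reading `IH` on `τ` back at level `m` (doubling) leaves exactly:
(i) `{z, w} = {−2y, N}` (`s = α_y`); (ii) `{z, w} = {2y + N, −4y}` (`s = β_y`); (iii) `{2y, z, w}` is a full coset
`{x′, x′ + m/3, x′ + 2m/3}` (`τ` a `γ_{c′}` with `N/2 = −3c′`); (iv) `y, z, w` all divisible by `3` (`τ` a `γ_{c′}` with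
`3 ∣ c′`, using `9 ∣ N`; when `4 ∣ N` the case `τ = γ_{c′}` is void: `N/2, N/3` are even, so every member of a `γ_{c′} ∋ N/2`
is even, while `ȳ` is odd); (v) a common divisor `d ≥ 2` of `N`, `⟨y⟩`, `⟨z⟩/2`, `⟨w⟩/2` (`τ` a lift from a level
`≤ 72 < N`). This formalisation's lemma towards [Aoki1983, Thm. C] at the levels `2ᵃ3ᵇ` (parts II–IV: `9 ∣ N`) and `3·2ᵃ`
(`4 ∣ N`).
[cite: Aoki1983, Prop. 2.2; Thm. C] [cite: Shioda1982PicardFermat, Prop. 4 (Q′) p. 729, Lemma 1 p. 728] -/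
theorem twin_transfer (hmN : m = 2 * N) (h2 : 2 ∣ N) (h3 : 3 ∣ N) (h49 : 4 ∣ N ∨ 9 ∣ N) (h72 : 72 < N)
    (IH : ∀ t : Multiset (ZMod N), IsHodgeMultiset t → card t = 4 → ¬ HasPair t → IsStdMultiset N t ∨ IsSmallLift N t)
    {s : Multiset (ZMod m)} (hs : IsHodgeMultiset s) (hpf : ¬ HasPair s) {y z w : ZMod m}
    (hsx : s = y ::ₘ (y + ((N : ℕ) : ZMod m)) ::ₘ {z, w}) (hy1 : y.val % 2 = 1) (hz0 : z.val % 2 = 0)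
    (hw0 : w.val % 2 = 0) :
    (z ::ₘ {w} = (-(2 * y)) ::ₘ {((N : ℕ) : ZMod m)}) ∨
    (z ::ₘ {w} = (2 * y + ((N : ℕ) : ZMod m)) ::ₘ {-(4 * y)}) ∨
    (∃ x' : ZMod m, (2 * y) ::ₘ z ::ₘ {w} =
      x' ::ₘ (x' + ((m / 3 : ℕ) : ZMod m)) ::ₘ {x' + 2 * ((m / 3 : ℕ) : ZMod m)}) ∨
    (3 ∣ y.val ∧ 3 ∣ z.val ∧ 3 ∣ w.val) ∨
    (∃ d : ℕ, 2 ≤ d ∧ d ∣ N ∧ d ∣ y.val ∧ d ∣ z.val / 2 ∧ d ∣ w.val / 2) := by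
  classical
  have hN0 := NeZero.pos N
  have hNm : N ∣ m := ⟨2, by rw [hmN]; ring⟩
  obtain ⟨K, hK⟩ : ∃ K, N = 2 * K := h2
  have hKv : N / 2 = K := by rw [hK, Nat.mul_div_cancel_left _ two_pos]
  set H : ZMod m := ((N : ℕ) : ZMod m) with hH
  set Q : ZMod N := ((K : ℕ) : ZMod N) with hQ
  have hQ' : (((N / 2 : ℕ)) : ZMod N) = Q := by rw [hKv]
  have hHH : H + H = 0 := by
    have e : H + H = ((m : ℕ) : ZMod m) := by rw [hH, hmN]; push_cast; ring
    rw [e, ZMod.natCast_self]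
  have hQQ : -Q = Q := neg_half hK
  have hQval : Q.val = K := val_half hK
  have hQ0 : Q ≠ 0 := fun e ↦ by have := congrArg ZMod.val e; rw [hQval, ZMod.val_zero] at this; omega
  have hRH : ZMod.castHom hNm (ZMod N) H = 0 := by rw [hH, map_natCast, ZMod.natCast_self]
  -- members of `s`
  have hy : y ∈ s := by rw [hsx]; simp
  have hz : z ∈ s := by rw [hsx]; simp
  have hw : w ∈ s := by rw [hsx]; simp
  have hz_ne : z ≠ 0 := hs.1.1 z hz
  have hw_ne : w ≠ 0 := hs.1.1 w hw
  have hsplit : s = (y ::ₘ {y + H}) + (z ::ₘ {w}) := by rw [hsx]; rfl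
  have hzw : z + w = -(2 * y + H) := by
    have hsum := hs.1.2
    rw [hsx] at hsum
    simp only [Multiset.insert_eq_cons, Multiset.sum_cons, Multiset.sum_singleton] at hsum
    linear_combination hsum
  -- the transfer
  have hyH1 : (y + H).val % 2 = 1 := by
    have e : (y + H).val % 2 = (y.val + H.val) % 2 := by
      rw [ZMod.val_add, Nat.mod_mod_of_dvd _ ⟨N, hmN⟩]
    rw [e, hH, ZMod.val_natCast, Nat.mod_eq_of_lt (show N < m by omega), Nat.add_mod, hy1, hK]
    simp
  have hT := transfer_two' hmN ⟨K, hK⟩ hNm (s₁ := y ::ₘ {y + H}) (s₀ := z ::ₘ {w})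
    (by intro v hv; simp only [Multiset.mem_cons, Multiset.mem_singleton] at hv
        rcases hv with rfl | rfl
        · exact hy1
        · exact hyH1)
    (by intro v hv; simp only [Multiset.mem_cons, Multiset.mem_singleton] at hv
        rcases hv with rfl | rfl <;> assumption)
    (hsplit ▸ hs)
  have hRyH : ZMod.castHom hNm (ZMod N) (y + H) = ZMod.castHom hNm (ZMod N) y := by
    rw [RingHom.map_add, hRH, add_zero]
  simp only [Multiset.map_cons, Multiset.map_singleton, hRyH] at hT
  set c := ZMod.castHom hNm (ZMod N) y with hc
  set zt := ZMod.castHom hNm (ZMod N) (half z) with hzt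
  set wt := ZMod.castHom hNm (ZMod N) (half w) with hwt
  -- `hT : IsHodgeMultiset (c ::ₘ {c} + 2 • (zt ::ₘ {wt}))`
  have hc1 : c.val % 2 = 1 := by rw [hc, val_castHom_mod_two hNm ⟨K, hK⟩, hy1]
  have hcval : c.val = y.val % N := val_castHom' hNm y
  have hztval : zt.val = z.val / 2 % N := by rw [hzt, val_castHom' hNm, val_half_eq]
  have hwtval : wt.val = w.val / 2 % N := by rw [hwt, val_castHom' hNm, val_half_eq]
  have hc0 : c ≠ 0 := fun e ↦ by rw [e, ZMod.val_zero] at hc1; omega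
  have hzt0 : zt ≠ 0 := fun e ↦ by
    have h1 := congrArg ZMod.val e
    rw [hztval, ZMod.val_zero, Nat.mod_eq_of_lt (by have := ZMod.val_lt z; omega)] at h1
    have : z.val = 0 := by omega
    exact hz_ne ((ZMod.val_eq_zero z).mp this)
  have hwt0 : wt ≠ 0 := fun e ↦ by
    have h1 := congrArg ZMod.val e
    rw [hwtval, ZMod.val_zero, Nat.mod_eq_of_lt (by have := ZMod.val_lt w; omega)] at h1
    have : w.val = 0 := by omega
    exact hw_ne ((ZMod.val_eq_zero w).mp this)
  -- the doubles
  have hdc : dbl m c = 2 * y := dbl_castHom hmN hNm y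
  have hdz : dbl m zt = z := dbl_castHom_half hmN hNm (Nat.dvd_of_mod_eq_zero hz0)
  have hdw : dbl m wt = w := dbl_castHom_half hmN hNm (Nat.dvd_of_mod_eq_zero hw0)
  have hdQ : dbl m Q = H := by rw [← hQ', (dbl_half_third hmN ⟨K, hK⟩ h3).1, hH, hmN, Nat.mul_div_cancel_left _ two_pos]
  have hdR : dbl m (((N / 3 : ℕ)) : ZMod N) = ((m / 3 : ℕ) : ZMod m) := (dbl_half_third hmN ⟨K, hK⟩ h3).2
  -- norm and sum of `{c, zt, wt}`
  obtain ⟨⟨-, hTsum⟩, hTnorm⟩ := hT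
  have hA : ∀ v : (ZMod N)ˣ,
      ((v : ZMod N) * c).val + ((v : ZMod N) * zt).val + ((v : ZMod N) * wt).val = 3 * K := by
    intro v
    have h := hTnorm v
    simp only [Multiset.map_add, Multiset.map_cons, Multiset.map_singleton, mNormSum_add, mNormSum_cons,
      Multiset.card_add, Multiset.card_cons, Multiset.card_singleton, Multiset.map_nsmul, mNormSum_nsmul',
      Multiset.card_nsmul] at h
    simp only [mNormSum, Multiset.map_singleton, Multiset.sum_singleton] at h
    omega
  have hsum3 : c + zt + wt = Q := by
    have h2 : (2 : ZMod N) * (c + zt + wt) = 0 := by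
      simp only [Multiset.sum_add, Multiset.sum_cons, Multiset.sum_singleton, Multiset.sum_nsmul] at hTsum
      linear_combination hTsum
    rcases eq_zero_or_eq_half hK h2 with h | h
    · exfalso
      have h1 := hA 1
      simp only [Units.val_one, one_mul] at h1
      have hcast : (((c.val + zt.val + wt.val : ℕ)) : ZMod N) = c + zt + wt := by
        push_cast; simp only [ZMod.natCast_zmod_val]
      rw [h1, h, show ((3 * K : ℕ) : ZMod N) = ((K : ℕ) : ZMod N) + ((N : ℕ) : ZMod N) by rw [hK]; push_cast; ring,
        ZMod.natCast_self, add_zero] at hcast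
      exact hQ0 hcast
    · exact h
  -- `τ = {c, zt, wt, Q}` is a Hodge quadruple of level `N`
  have hτ : IsHodgeMultiset ({c, zt, wt, Q} : Multiset (ZMod N)) := by
    refine ⟨⟨?_, ?_⟩, fun v ↦ ?_⟩
    · intro a ha
      simp only [Multiset.insert_eq_cons, Multiset.mem_cons, Multiset.mem_singleton] at ha
      rcases ha with rfl | rfl | rfl | rfl <;> assumption
    · simp only [Multiset.insert_eq_cons, Multiset.sum_cons, Multiset.sum_singleton]
      linear_combination hsum3 - hQQ
    · have hvQ : ((v : ZMod N) * Q).val = K := by rw [hQ, unit_mul_half hK v, val_half hK]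
      simp only [Multiset.insert_eq_cons, Multiset.map_cons, Multiset.map_singleton, mNormSum_cons, Multiset.card_cons,
        Multiset.card_singleton]
      simp only [mNormSum, Multiset.map_singleton, Multiset.sum_singleton, hvQ]
      have := hA v
      omega
  -- pairs in `τ` that would be pairs in `s`
  have hzwt : zt + wt ≠ 0 := by
    intro e
    apply hpf
    refine ⟨z, hz, ?_⟩
    have ew : -z = w := by
      have := congrArg (dbl m) e
      rw [dbl_add hmN, hdz, hdw, dbl_zero] at this
      linear_combination -this
    rw [hsx, ew]
    exact mem_erase_quad _ _ _ _
  have hcQ : c ≠ Q := by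
    intro e
    apply hpf
    refine ⟨y, hy, ?_⟩
    have e2 : 2 * y = H := by rw [← hdc, e, hdQ]
    have ey : -y = y + H := by linear_combination -e2 - hHH
    rw [hsx, Multiset.erase_cons_head, ey]
    simp
  -- case `zt = Q` or `wt = Q`: `{z, w} = {N, −2y}`, alternative (i)
  by_cases hztQ : zt = Q
  · left
    have ez : z = H := by rw [← hdz, hztQ, hdQ]
    have ew : w = -(2 * y) := by linear_combination hzw - ez - hHH
    rw [ez, ew]
    exact Multiset.pair_comm _ _
  by_cases hwtQ : wt = Q
  · left
    have ew : w = H := by rw [← hdw, hwtQ, hdQ]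
    have ez : z = -(2 * y) := by linear_combination hzw - ew - hHH
    rw [ez, ew]
  -- case `c + zt = 0` or `c + wt = 0`: again alternative (i)
  by_cases h1 : c + zt = 0
  · left
    have ez : z = -(2 * y) := by
      have := congrArg (dbl m) h1
      rw [dbl_add hmN, hdc, hdz, dbl_zero] at this
      linear_combination this
    have ew : w = H := by linear_combination hzw - ez - hHH
    rw [ez, ew]
  by_cases h1' : c + wt = 0
  · left
    have ew : w = -(2 * y) := by
      have := congrArg (dbl m) h1'
      rw [dbl_add hmN, hdc, hdw, dbl_zero] at this
      linear_combination this
    have ez : z = H := by linear_combination hzw - ew - hHH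
    rw [ez, ew]
    exact Multiset.pair_comm _ _
  -- otherwise `τ` is pair-free
  have hτpf : ¬ HasPair ({c, zt, wt, Q} : Multiset (ZMod N)) := by
    have e : ({c, zt, wt, Q} : Multiset (ZMod N)) = univ.val.map ![c, zt, wt, Q] := by
      simp [Fin.univ_val_map]; rfl
    rw [e]
    refine not_hasPair_of_indecomposable fun i j hij h ↦ ?_
    fin_cases i <;> fin_cases j <;> simp at hij h <;>
      first
      | exact h1 (by linear_combination h)
      | exact h1' (by linear_combination h)
      | exact hzwt (by linear_combination h)
      | exact hcQ (by linear_combination h + hQQ)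
      | exact hztQ (by linear_combination h + hQQ)
      | exact hwtQ (by linear_combination h + hQQ)
  rcases IH {c, zt, wt, Q} hτ (by simp) hτpf with ⟨c', ⟨-, hα | hβ⟩ | ⟨-, hγ⟩⟩ | ⟨d, hdN, hdle, hdall⟩
  · -- `τ = α_{c'} = {c', c' + Q, −2c', Q}`
    rw [hQ'] at hα
    right; left
    have e' := congrArg (Multiset.map (dbl m)) hα
    simp only [Multiset.insert_eq_cons, Multiset.map_cons, Multiset.map_singleton, dbl_add hmN, dbl_neg hmN,
      dbl_two_mul hmN, hdz, hdw, hdc, hdQ] at e'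
    have hx'0 : (dbl m c').val % 2 = 0 := by rw [val_dbl hmN]; omega
    exact pair_eq_of_alpha_shape hmN ⟨K, hK⟩ hy1 hx'0 hHH e'
  · -- `τ = β_{c'}` through `Q`: then `Q = −4c'` and it is the `α_{c'}` case, or `τ` would contain `0`
    rw [hQ'] at hβ
    have mem : Q ∈ ({c', c' + Q, 2 * c' + Q, -(4 * c')} : Multiset (ZMod N)) := by rw [← hβ]; simp
    simp only [Multiset.insert_eq_cons, Multiset.mem_cons, Multiset.mem_singleton] at mem
    have hc'0 : c' ≠ 0 := by
      intro e
      have : (0 : ZMod N) ∈ ({c, zt, wt, Q} : Multiset (ZMod N)) := by rw [hβ, e]; simp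
      exact hτ.1.1 0 this rfl
    have hc'Q : c' ≠ Q := by
      intro e
      have : (0 : ZMod N) ∈ ({c, zt, wt, Q} : Multiset (ZMod N)) := by
        rw [hβ, e, show Q + Q = 0 by linear_combination -hQQ]; simp
      exact hτ.1.1 0 this rfl
    rcases mem with e' | e' | e' | e'
    · exact absurd e'.symm hc'Q
    · exact absurd (by linear_combination -e' : c' = 0) hc'0
    · have h2c : (2 : ZMod N) * c' = 0 := by linear_combination -e'
      rcases eq_zero_or_eq_half hK h2c with h0 | h0
      · exact absurd h0 hc'0
      · exact absurd h0 hc'Q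
    · have hα : ({c, zt, wt, Q} : Multiset (ZMod N)) = {c', c' + Q, -(2 * c'), Q} := by
        rw [hβ, show 2 * c' + Q = -(2 * c') by rw [e']; ring, ← e']
      right; left
      have e'2 := congrArg (Multiset.map (dbl m)) hα
      simp only [Multiset.insert_eq_cons, Multiset.map_cons, Multiset.map_singleton, dbl_add hmN, dbl_neg hmN,
        dbl_two_mul hmN, hdz, hdw, hdc, hdQ] at e'2
      have hx'0 : (dbl m c').val % 2 = 0 := by rw [val_dbl hmN]; omega
      exact pair_eq_of_alpha_shape hmN ⟨K, hK⟩ hy1 hx'0 hHH e'2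
  · -- `τ = γ_{c'} = {c', c' + N/3, c' + 2N/3, −3c'}`
    set T : ZMod N := ((N / 3 : ℕ) : ZMod N) with hTdef
    have mem : Q ∈ ({c', c' + T, c' + 2 * T, -(3 * c')} : Multiset (ZMod N)) := by rw [← hγ]; simp
    simp only [Multiset.insert_eq_cons, Multiset.mem_cons, Multiset.mem_singleton] at mem
    have hTval : T.val = N / 3 := by
      rw [hTdef, ZMod.val_natCast, Nat.mod_eq_of_lt (Nat.div_lt_self hN0 (by norm_num))]
    rcases h49 with h4 | h9
    · -- `4 ∣ N`: `⟨Q⟩ = N/2` and `⟨T⟩ = N/3` are even, so every member of `γ_{c'} ∋ Q` is even — but `c` is odd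
      exfalso
      have h2N' : (2 : ℕ) ∣ N := ⟨K, hK⟩
      set ρ₂ := ZMod.castHom h2N' (ZMod 2) with hρ₂
      have cast2 : ∀ x : ZMod N, 2 ∣ x.val ↔ ρ₂ x = 0 := fun x ↦ by
        rw [ZMod.castHom_apply, ZMod.cast_eq_val, ZMod.natCast_eq_zero_iff]
      have ρQ : ρ₂ Q = 0 := (cast2 Q).mp (by rw [hQval]; obtain ⟨e, he⟩ := h4; exact ⟨e, by omega⟩)
      have ρT : ρ₂ T = 0 := (cast2 T).mp (by rw [hTval]; obtain ⟨e, he⟩ := h4; obtain ⟨f, hf⟩ := h3; exact ⟨f / 2, by omega⟩)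
      have h31 : (3 : ZMod 2) = 1 := by decide
      have ρc : ρ₂ c' = 0 := by
        rcases mem with e | e | e | e
        · rw [← e]; exact ρQ
        · have := congrArg ρ₂ e
          rw [_root_.map_add, ρT, add_zero, ρQ] at this
          exact this.symm
        · have := congrArg ρ₂ e
          rw [_root_.map_add, _root_.map_mul, ρT, mul_zero, add_zero, ρQ] at this
          exact this.symm
        · have := congrArg ρ₂ e
          rw [_root_.map_neg, _root_.map_mul, map_ofNat, h31, one_mul, ρQ] at this
          linear_combination this
      have hall : ∀ a ∈ ({c, zt, wt, Q} : Multiset (ZMod N)), 2 ∣ a.val := by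
        rw [hγ]
        intro a ha
        rw [cast2]
        simp only [Multiset.insert_eq_cons, Multiset.mem_cons, Multiset.mem_singleton] at ha
        rcases ha with rfl | rfl | rfl | rfl
        · exact ρc
        · rw [_root_.map_add, ρc, ρT, add_zero]
        · rw [_root_.map_add, _root_.map_mul, ρc, ρT, mul_zero, add_zero]
        · rw [_root_.map_neg, _root_.map_mul, ρc, mul_zero, neg_zero]
      have hc2 := hall c (by simp)
      rw [hcval, Nat.dvd_mod_iff h2N'] at hc2
      omega
    -- `9 ∣ N`: `3 ∣ ⟨T⟩` and `3 ∣ ⟨Q⟩`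
    have h3T : 3 ∣ T.val := by
      rw [hTval]
      obtain ⟨e, he⟩ := h9
      exact ⟨e, by rw [he]; omega⟩
    have h3Q : 3 ∣ Q.val := by
      rw [hQval]
      obtain ⟨e, he⟩ := h3
      exact ⟨e / 2, by omega⟩
    have h3N' : (3 : ℕ) ∣ N := h3
    have cast3 : ∀ x : ZMod N, 3 ∣ x.val ↔ ZMod.castHom h3N' (ZMod 3) x = 0 := fun x ↦ by
      rw [ZMod.castHom_apply, ZMod.cast_eq_val, ZMod.natCast_eq_zero_iff]
    by_cases hQc : Q = -(3 * c')
    · -- (iii): `{c, zt, wt} = {c', c' + T, c' + 2T}`; double it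
      right; right; left
      have e3 : ({c, zt, wt, Q} : Multiset (ZMod N)) = {c', c' + T, c' + 2 * T, Q} := by rw [hγ, hQc]
      have e4 : (c ::ₘ zt ::ₘ ({wt} : Multiset (ZMod N))) = c' ::ₘ (c' + T) ::ₘ {c' + 2 * T} := by
        simp only [Multiset.insert_eq_cons] at e3
        have e'' : (c ::ₘ zt ::ₘ ({wt} : Multiset (ZMod N))) + {Q} = (c' ::ₘ (c' + T) ::ₘ {c' + 2 * T}) + {Q} := by
          simp only [Multiset.singleton_add, Multiset.cons_add]
          exact e3
        exact add_right_cancel e''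
      have e5 := congrArg (Multiset.map (dbl m)) e4
      simp only [Multiset.map_cons, Multiset.map_singleton, dbl_add hmN, dbl_two_mul hmN, hdz, hdw, hdc] at e5
      rw [hTdef, hdR] at e5
      exact ⟨dbl m c', e5⟩
    · -- (iv): `c' ≡ Q (mod T)`, so `3 ∣ c'` and all members of `γ_{c'}` are divisible by `3`
      right; right; right; left
      set ρ := ZMod.castHom h3N' (ZMod 3) with hρ
      have ρT : ρ T = 0 := (cast3 T).mp h3T
      have ρQ : ρ Q = 0 := (cast3 Q).mp h3Q
      have ρc : ρ c' = 0 := by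
        rcases mem with e | e | e | e
        · rw [← e]; exact ρQ
        · have := congrArg ρ e
          rw [_root_.map_add, ρT, add_zero, ρQ] at this
          exact this.symm
        · have := congrArg ρ e
          rw [_root_.map_add, _root_.map_mul, ρT, mul_zero, add_zero, ρQ] at this
          exact this.symm
        · exact absurd e hQc
      have hall : ∀ a ∈ ({c, zt, wt, Q} : Multiset (ZMod N)), 3 ∣ a.val := by
        rw [hγ]
        intro a ha
        rw [cast3]
        simp only [Multiset.insert_eq_cons, Multiset.mem_cons, Multiset.mem_singleton] at ha
        rcases ha with rfl | rfl | rfl | rfl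
        · exact ρc
        · rw [_root_.map_add, ρc, ρT, add_zero]
        · rw [_root_.map_add, _root_.map_mul, ρc, ρT, mul_zero, add_zero]
        · rw [_root_.map_neg, _root_.map_mul, ρc, mul_zero, neg_zero]
      have hc3 := hall c (by simp)
      have hz3 := hall zt (by simp)
      have hw3 := hall wt (by simp)
      rw [hcval, Nat.dvd_mod_iff h3] at hc3
      rw [hztval, Nat.dvd_mod_iff h3] at hz3
      rw [hwtval, Nat.dvd_mod_iff h3] at hw3
      have ez : z.val = 2 * (z.val / 2) := by omega
      have ew : w.val = 2 * (w.val / 2) := by omega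
      exact ⟨hc3, ez ▸ dvd_mul_of_dvd_right hz3 2, ew ▸ dvd_mul_of_dvd_right hw3 2⟩
  · -- (v): a lift from a level `≤ 72 < N`
    right; right; right; right
    have hd2 : 2 ≤ d := by
      by_contra hlt
      interval_cases d <;> omega
    have hc' := hdall c (by simp)
    have hz' := hdall zt (by simp)
    have hw' := hdall wt (by simp)
    rw [hcval, Nat.dvd_mod_iff hdN] at hc'
    rw [hztval, Nat.dvd_mod_iff hdN] at hz'
    rw [hwtval, Nat.dvd_mod_iff hdN] at hw'
    exact ⟨d, hd2, hdN, hc', hz', hw'⟩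

end Step

/-! ## Assembly at the levels `m = 2ᵃ3ᵇ`: the unit case and the inductive step -/

section Assembly

variable {m n i k : ℕ} [NeZero m]

/-- `𝔫 = n = m/6` as a residue modulo `m = 6n`. -/
local notation "𝔫" => (((n : ℕ)) : ZMod m)

omit [NeZero m] in
/-- `2 ∣ 3n` and `9 ∣ 3n` for `n = 2ⁱ3ᵏ`, `i, k ≥ 1`. [folklore] -/
private theorem dvd_three_mul_n (hn : n = 2 ^ i * 3 ^ k) (hi : 1 ≤ i) (hk : 1 ≤ k) : 2 ∣ 3 * n ∧ 9 ∣ 3 * n := by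
  obtain ⟨i', rfl⟩ := Nat.exists_eq_add_of_le' hi
  obtain ⟨k', rfl⟩ := Nat.exists_eq_add_of_le' hk
  exact ⟨⟨3 * 2 ^ i' * 3 ^ (k' + 1), by rw [hn]; ring⟩, ⟨2 ^ (i' + 1) * 3 ^ k', by rw [hn]; ring⟩⟩

omit [NeZero m] in
/-- `2 ∣ 2n` and `3 ∣ 2n` for `n = 2ⁱ3ᵏ`, `k ≥ 1`. [folklore] -/
private theorem dvd_two_mul_n (hn : n = 2 ^ i * 3 ^ k) (hk : 1 ≤ k) : 2 ∣ 2 * n ∧ 3 ∣ 2 * n := by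
  obtain ⟨k', rfl⟩ := Nat.exists_eq_add_of_le' hk
  exact ⟨⟨n, rfl⟩, ⟨2 * 2 ^ i * 3 ^ k', by rw [hn]; ring⟩⟩

omit [NeZero m] in
/-- A number `d ≥ 2` dividing `3n = 2ⁱ3ᵏ⁺¹` is divisible by `2` or by `3`. [folklore] -/
private theorem two_or_three_dvd_of_dvd (hn : n = 2 ^ i * 3 ^ k) {d : ℕ} (hd2 : 2 ≤ d) (hdN : d ∣ 3 * n) :
    2 ∣ d ∨ 3 ∣ d := by
  have hp : d.minFac.Prime := Nat.minFac_prime (by omega)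
  have hpd : d.minFac ∣ d := Nat.minFac_dvd d
  have hpN : d.minFac ∣ 2 ^ i * 3 ^ (k + 1) := by
    rw [show 2 ^ i * 3 ^ (k + 1) = 3 * n by rw [hn]; ring]
    exact dvd_trans hpd hdN
  rcases (Nat.Prime.dvd_mul hp).mp hpN with h | h
  · have := (Nat.prime_dvd_prime_iff_eq hp Nat.prime_two).mp (hp.dvd_of_dvd_pow h)
    exact Or.inl (this ▸ hpd)
  · have := (Nat.prime_dvd_prime_iff_eq hp Nat.prime_three).mp (hp.dvd_of_dvd_pow h)
    exact Or.inr (this ▸ hpd)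

/-- `3t = 0` in `ℤ/6n` forces `t ∈ {0, 2n, 4n}`. [folklore] -/
private theorem eq_of_three_mul_eq_zero (hm : m = 6 * n) {t : ZMod m} (h : (3 : ZMod m) * t = 0) :
    t = 0 ∨ t = 2 * 𝔫 ∨ t = 4 * 𝔫 := by
  have ht := ZMod.val_lt t
  have hdiv : m ∣ 3 * t.val := by
    rw [← ZMod.natCast_eq_zero_iff, Nat.cast_mul, Nat.cast_ofNat, ZMod.natCast_zmod_val, h]
  obtain ⟨c, hc⟩ := hdiv
  have hc3 : c < 3 := by
    by_contra hc3
    have : 3 * m ≤ m * c := by nlinarith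
    omega
  have key : t = (((2 * n * c : ℕ)) : ZMod m) := by
    rw [← ZMod.natCast_zmod_val t]
    congr 1
    have h3 : 3 * t.val = 3 * (2 * n * c) :=
      calc 3 * t.val = m * c := hc
        _ = 3 * (2 * n * c) := by rw [hm]; ring
    exact Nat.eq_of_mul_eq_mul_left (by norm_num) h3
  interval_cases c
  · left; rw [key]; simp
  · right; left; rw [key]; push_cast; ring
  · right; right; rw [key]; push_cast; ring

/-- **A pair-free Hodge quadruple with a unit member is standard** (`m = 2ᵃ3ᵇ`, `a, b ≥ 2`, `m > 144`, given the
classification at level `m/2`). Let `s` be a pair-free Hodge `4`-multiset over `ℤ/m`, `m = 6n`, `n = 2ⁱ3ᵏ`, `i, k ≥ 1`,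
`m > 144`, with a member `y` prime to `m`, and assume that every pair-free Hodge `4`-multiset over `ℤ/(m/2)` is standard or a
lift from a level `≤ 72`. Then `s` is `α_y`, `β_y` or `γ_y`: by `twin_or_gamma_twoThreePower` (part I) `s = γ_y` or `y` is
twinned, `s = {y, y + m/2, z, w}` with `z, w` even (`shape_of_twin_twoThreePower`); the twin transfer (`twin_transfer`)
leaves `α_y`, `β_y`, or three alternatives that contradict `(y, m) = 1` (`{2y, z, w}` a coset of `(m/3)ℤ` forces
`3(2y + n) = 0`, i.e. `3 ∣ y`; `3 ∣ y`; a divisor `d ≥ 2` of `m/2` dividing `⟨y⟩`). This is [Aoki1983, Thm. C] =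
[Shioda1982PicardFermat, Prop. 4 (Q′)] for the elements of `𝔅²ₘ` with a unit coordinate at these levels, by this
formalisation's route (Koblitz–Ogus relations and level transfer instead of Aoki's Thm. D).
[cite: Aoki1983, Thm. C p. 47; Prop. 2.2] [cite: Shioda1982PicardFermat, Prop. 4 (Q′) p. 729, Lemma 1 (a), (b) p. 728]
[cite: AokiShioda1983, Thm. (𝔅²ₘ) (ii) a), b), c)] -/
theorem isStdMultiset_of_unit_mem_twoThreePower (hm : m = 6 * n) (hn : n = 2 ^ i * 3 ^ k) (hi : 1 ≤ i) (hk : 1 ≤ k)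
    (h144 : 144 < m)
    (IH₂ : ∀ t : Multiset (ZMod (3 * n)), IsHodgeMultiset t → card t = 4 → ¬ HasPair t →
      IsStdMultiset (3 * n) t ∨ IsSmallLift (3 * n) t)
    {s : Multiset (ZMod m)} (hs : IsHodgeMultiset s) (hcard : card s = 4) (hpf : ¬ HasPair s) {y : ZMod m}
    (hy : y ∈ s) (hy2 : ¬ 2 ∣ y.val) (hy3 : ¬ 3 ∣ y.val) : IsStdMultiset m s := by
  classical
  have hn0 : 0 < n := by rw [hn]; positivity
  haveI : NeZero (3 * n) := ⟨by omega⟩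
  have h2m : 2 ∣ m := ⟨3 * n, by rw [hm]; ring⟩
  have h3m : 3 ∣ m := ⟨2 * n, by rw [hm]; ring⟩
  have hH : ((m / 2 : ℕ) : ZMod m) = 3 * 𝔫 := by rw [hm, show 6 * n / 2 = 3 * n by omega]; push_cast; ring
  have hR : ((m / 3 : ℕ) : ZMod m) = 2 * 𝔫 := by rw [hm, show 6 * n / 3 = 2 * n by omega]; push_cast; ring
  rcases twin_or_gamma_twoThreePower hm hn hi hk hs hcard hpf hy hy2 hy3 with htwin | hγ
  · obtain ⟨z, w, hs4, hzw, ⟨hz2, hw2⟩, -⟩ := shape_of_twin_twoThreePower hm hn hi hk hs hcard hpf hy hy2 hy3 htwin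
    have hmN : m = 2 * (3 * n) := by rw [hm]; ring
    have hN3 : (((3 * n : ℕ)) : ZMod m) = 3 * 𝔫 := by push_cast; ring
    have hsx : s = y ::ₘ (y + (((3 * n : ℕ)) : ZMod m)) ::ₘ {z, w} := by rw [hN3]; exact hs4
    obtain ⟨h2N, h9N⟩ := dvd_three_mul_n hn hi hk
    have h72 : 72 < 3 * n := by omega
    rcases twin_transfer hmN h2N (dvd_trans ⟨3, by norm_num⟩ h9N) (Or.inr h9N) h72 IH₂ hs hpf hsx (by omega)
      (Nat.mod_eq_zero_of_dvd hz2)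
      (Nat.mod_eq_zero_of_dvd hw2) with hA | hB | ⟨x', hx'⟩ | ⟨hy3', -, -⟩ | ⟨d, hd2, hdN, hdy, -, -⟩
    · -- `s = α_y`
      refine ⟨y, Or.inl ⟨h2m, Or.inl ?_⟩⟩
      rw [hN3] at hA
      rw [hs4, hH]
      simp only [Multiset.insert_eq_cons, hA]
    · -- `s = β_y`
      refine ⟨y, Or.inl ⟨h2m, Or.inr ?_⟩⟩
      rw [hN3] at hB
      rw [hs4, hH]
      simp only [Multiset.insert_eq_cons, hB]
    · -- `{2y, z, w}` a coset of `(m/3)ℤ`: then `3(2y + n) = 0`, contradicting `3 ∤ y`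
      exfalso
      rw [hR] at hx'
      have h6 : (6 : ZMod m) * 𝔫 = 0 := by
        have e : (6 : ZMod m) * ((n : ℕ) : ZMod m) = ((m : ℕ) : ZMod m) := by rw [hm]; push_cast; ring
        rw [e, ZMod.natCast_self]
      have hsum := congrArg Multiset.sum hx'
      simp only [Multiset.sum_cons, Multiset.sum_singleton] at hsum
      -- `hsum : 2y + (z + w) = x' + (x' + 2n + (x' + 2·2n))`, so `3x' = −3n`
      have h3x : 3 * x' = -(3 * 𝔫) := by linear_combination -hsum + hzw - h6
      have mem : (2 : ZMod m) * y ∈ (x' ::ₘ (x' + 2 * 𝔫) ::ₘ ({x' + 2 * (2 * 𝔫)} : Multiset (ZMod m))) := by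
        rw [← hx']; simp
      simp only [Multiset.mem_cons, Multiset.mem_singleton] at mem
      have h3t : (3 : ZMod m) * (2 * y + 𝔫) = 0 := by
        rcases mem with e | e | e
        · linear_combination (3 : ZMod m) * e + h3x
        · linear_combination (3 : ZMod m) * e + h3x + h6
        · linear_combination (3 : ZMod m) * e + h3x + 2 * h6
      set ρ := ZMod.castHom h3m (ZMod 3) with hρ
      have ρn : ρ 𝔫 = 0 := by
        rw [map_natCast, ZMod.natCast_eq_zero_iff]
        obtain ⟨k', rfl⟩ := Nat.exists_eq_add_of_le' hk
        exact ⟨2 ^ i * 3 ^ k', by rw [hn]; ring⟩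
      have ρy : ρ y ≠ 0 := fun e ↦ hy3 (by
        rw [ZMod.castHom_apply, ZMod.cast_eq_val, ZMod.natCast_eq_zero_iff] at e; exact e)
      have key : ∀ a : ZMod 3, a ≠ 0 → ∀ t : ZMod 3, (t = 0 ∨ t = 2 * 0 ∨ t = 4 * 0) → 2 * a + 0 = t → False := by decide
      rcases eq_of_three_mul_eq_zero hm h3t with e | e | e
      · exact key (ρ y) ρy (ρ (2 * y + 𝔫)) (Or.inl (by rw [e, _root_.map_zero])) (by rw [_root_.map_add, _root_.map_mul, ρn, map_ofNat])
      · exact key (ρ y) ρy (ρ (2 * y + 𝔫)) (Or.inr (Or.inl (by rw [e, _root_.map_mul, ρn, map_ofNat])))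
          (by rw [_root_.map_add, _root_.map_mul, ρn, map_ofNat])
      · exact key (ρ y) ρy (ρ (2 * y + 𝔫)) (Or.inr (Or.inr (by rw [e, _root_.map_mul, ρn, map_ofNat])))
          (by rw [_root_.map_add, _root_.map_mul, ρn, map_ofNat])
    · exact absurd hy3' hy3
    · -- a divisor `d ≥ 2` of `3n` divides `⟨y⟩`: but `y` is prime to `6`
      exfalso
      rcases two_or_three_dvd_of_dvd hn hd2 hdN with h | h
      · exact hy2 (dvd_trans h hdy)
      · exact hy3 (dvd_trans h hdy)
  · -- `s = γ_y`
    refine ⟨y, Or.inr ⟨h3m, ?_⟩⟩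
    rw [hγ, hR, show (2 : ZMod m) * (2 * 𝔫) = 4 * 𝔫 by ring]
    simp only [Multiset.insert_eq_cons]

/-- **The inductive step at the levels `m = 2ᵃ3ᵇ` (`a, b ≥ 2`, `m > 144`), modulo the mixed no-unit configurations.**
Let `m = 6n`, `n = 2ⁱ3ᵏ`, `i, k ≥ 1`, `m > 144`. Assume the classification ("standard, or a lift from a level `≤ 72`") of the
pair-free Hodge `4`-multisets at the levels `m/2 = 3n` and `m/3 = 2n`, and assume that no pair-free Hodge `4`-multiset over
`ℤ/m` without a member prime to `m` is MIXED (has an odd member and a member prime to `3`). Then every pair-free Hodge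
`4`-multiset `s` over `ℤ/m` is standard (`α_x`, `β_x`, `γ_x`) or a lift from a level `≤ 72`: a member prime to `m` makes `s`
standard (`isStdMultiset_of_unit_mem_twoThreePower`); otherwise every member is even or divisible by `3`, and by the
non-mixing hypothesis all are even (`std_or_small_of_all_even`, level `m/2`) or all are divisible by `3`
(`std_or_small_of_all_three`, level `m/3`). Towards [Aoki1983, Thm. C] = [Shioda1982PicardFermat, Prop. 4 (Q′)] at the levels
`2ᵃ3ᵇ` (this formalisation's route; the mixed case is the subject of part III).
[cite: Aoki1983, Thm. C p. 47; Prop. 2.2] [cite: Shioda1982PicardFermat, Prop. 4 (Q′) p. 729, §2 p. 726]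
[cite: AokiShioda1983, Thm. (𝔅²ₘ) (ii)] -/
theorem std_or_small_step_twoThreePower (hm : m = 6 * n) (hn : n = 2 ^ i * 3 ^ k) (hi : 1 ≤ i) (hk : 1 ≤ k)
    (h144 : 144 < m)
    (IH₂ : ∀ t : Multiset (ZMod (3 * n)), IsHodgeMultiset t → card t = 4 → ¬ HasPair t →
      IsStdMultiset (3 * n) t ∨ IsSmallLift (3 * n) t)
    (IH₃ : ∀ t : Multiset (ZMod (2 * n)), IsHodgeMultiset t → card t = 4 → ¬ HasPair t →
      IsStdMultiset (2 * n) t ∨ IsSmallLift (2 * n) t)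
    (hmix : ∀ s : Multiset (ZMod m), IsHodgeMultiset s → card s = 4 → ¬ HasPair s →
      (∀ a ∈ s, 2 ∣ a.val ∨ 3 ∣ a.val) → (∃ a ∈ s, ¬ 2 ∣ a.val) → (∃ a ∈ s, ¬ 3 ∣ a.val) → False)
    {s : Multiset (ZMod m)} (hs : IsHodgeMultiset s) (hcard : card s = 4) (hpf : ¬ HasPair s) :
    IsStdMultiset m s ∨ IsSmallLift m s := by
  classical
  have hn0 : 0 < n := by rw [hn]; positivity
  by_cases hunit : ∃ y ∈ s, ¬ 2 ∣ y.val ∧ ¬ 3 ∣ y.val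
  · obtain ⟨y, hy, hy2, hy3⟩ := hunit
    exact Or.inl (isStdMultiset_of_unit_mem_twoThreePower hm hn hi hk h144 IH₂ hs hcard hpf hy hy2 hy3)
  push Not at hunit
  have hnu : ∀ a ∈ s, 2 ∣ a.val ∨ 3 ∣ a.val := fun a ha ↦ by
    by_cases h2 : 2 ∣ a.val
    · exact Or.inl h2
    · exact Or.inr (hunit a ha h2)
  by_cases hall2 : ∀ a ∈ s, 2 ∣ a.val
  · haveI : NeZero (3 * n) := ⟨by omega⟩
    obtain ⟨h2N, h9N⟩ := dvd_three_mul_n hn hi hk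
    exact std_or_small_of_all_even (N := 3 * n) (by rw [hm]; ring) h2N (dvd_trans ⟨3, by norm_num⟩ h9N) IH₂ hs hcard
      hpf hall2
  by_cases hall3 : ∀ a ∈ s, 3 ∣ a.val
  · haveI : NeZero (2 * n) := ⟨by omega⟩
    obtain ⟨h2N, h3N⟩ := dvd_two_mul_n (i := i) hn hk
    exact std_or_small_of_all_three (N := 2 * n) (by rw [hm]; ring) h2N h3N IH₃ hs hcard hpf hall3
  push Not at hall2 hall3
  exact (hmix s hs hcard hpf hnu hall2 hall3).elim

end Assembly

end Literature.AlgebraicGeometry.Shioda1982
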